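import Summits.BirchSwinnertonDyer.Rank1Residual.GaloisImage.HauptmodulThreeQuarticValuation
import HarnessLib

/-!
# The non-canonical root of the level-`3` Hauptmodul quartic at `v₃(j) = 3k + 3 ≥ 6`:
# `w = (S − 24)/3^{k+1}` is a unit with `v(w − w₀)³ = v(3)` (`w₀ = ±1 ≡ j/3^{v₃(j)} (mod 3)`), and the
# numerator of `X³ − 1` for `X = −2w₀(w − w₀)/θ` has valuation `v(3)·v(w − w₀)`
# (cell `b2b-bsdres`, team n1011, seat p02 gen 5 — row T-b11-F4, file F4c-H12 'Hauptmodul route,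
# curve-free core at v₃(j) ≡ 0 (mod 3), v₃(j) ≥ 6, part 1'; pure valuation algebra in `ℚ̄`)

HONEST FRAMING (cell `b2b-bsdres`, run/shared/lean/b2b/bsd-rank1-residual/, verbatim in every
file): the goal of the cell is to DELETE the COMBINATION-SHAPED residual classes of the
Birch–Swinnerton-Dyer formula for ALL analytic-rank `≤ 1` elliptic curves over `ℚ` — "full BSD
formula for every rank `≤ 1` curve in class `C`" assembled STRICTLY from published theorems — so
that the rank-`≤ 1` remainder becomes exactly the CONSTRUCTION-SHAPED classes, which are TYPED
(missing-input `Prop`s), NOT attempted. This is not "finishing BSD". Team n1011 (N10 / N11):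
research route; no claim beyond the stated classes; labels UNCHANGED; nothing is booked. Theorems
only (no definition, no named fact).

## What this file proves

`v` the place of `ℚ̄` over `3`, `t = v(3)`.  At `j = 0` the level-`3` quartic in `ρ = S/3 − 2` is
`(ρ − 6)³(ρ + 2)`; with `δ = ρ − 6` it reads `δ³(δ + 8) = 3J(δ − 1)` (`J = j/81`) EXACTLY.  For
`v₃(j) = V = 3k + 3` (`k ≥ 1`) put `K = j/3^V` (a `3`-adic unit) and `δ = 3^k w`:
**`w³(3^k w + 8) = K(3^k w − 1)`**, and `S = 3(3^k w + 8)`.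

* `valuation_w_eq_one` (§1) — `v(K) = 1`, `v(3^k w + 8) = 1` (non-canonical `S`) ⟹ `v(w) = 1`.
* `valuation_w_cube_sub_eq` (§1) — if moreover `v(K + 2w₀) ≤ t²` with `w₀ = ±1`
  (`K ≡ −2w₀ (mod 9)`): `v(w³ − w₀) = t`.
* `valuation_sub_one_pow_three_of_cube_eq` (§2) — `v(X³ − 1) = t` ⟹ `v(X − 1)³ = t`; hence
  `v(w − w₀)³ = t`.
* `valuation_numerator_of_delta_quartic` (§3) — with `s₁ = v(w − w₀)` (`s₁³ = t`):
  `v(−8w₀(w − w₀)³ − 3(3^k w + 8)) = t·s₁`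
  (`(w − w₀)³ = (w³ − w₀) − 3w₀w(w − w₀)`, and `−8w₀(w³ − w₀)(3^k w + 8) − 3(3^k w + 8)²` has
  valuation `≤ t²`: the constants `64 − 192 + 8w₀K ≡ 8w₀(K + 2w₀) (mod 144)` cancel to order `2`).

Part 2 (`HauptmodulNineValuationVZero`) concludes with the cube-root lemma: for `θ³ = S`,
`X = −2w₀(w − w₀)/θ` has `v(X³ − 1)³ = t`, so `v(X − 1)⁹ = t` and the `Stab(C)`-invariant
`z = (2((θ³ − 24)/3^{k+1} − w₀)/θ)² − 1 = X² − 1` has `v(z)⁹ = v(3)` — valuation `1/9` — on the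
family `v₃(j) ≡ 0 (mod 3)`, `v₃(j) ≥ 6`, `j/3^{v₃(j)} ≡ ±2 (mod 9)` of the EXOTIC core (155 census
cells: 94 at `V = 6`, 27 at `V = 9`, 34 at `V ≥ 12`; EVIDENCE kit j135556, 155/155; the classes
`j/3^V ≡ ±1 (mod 9)` have `9 ∤ e·f` for every prime of `ℚ(θ)` over `3` and are NOT covered).
Nothing booked.

References: [Maier2006] Table 4 (N = 3, 9), §5.
-/

noncomputable section

set_option maxRecDepth 10000

open scoped Classical

namespace Summit.BirchSwinnertonDyer.Rank1Residual.GaloisImage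

open Literature.NumberTheory.EllipticCurves Literature.NumberTheory.GaloisRepresentations
  Rat.HeightOneSpectrum

/-! ### §1 `w` is a unit and `w³ ≡ w₀ (mod 3)` exactly -/

/-- **`v(w) = 1`** for a solution of `w³(3^k w + 8) = K(3^k w − 1)` with `v(K) = 1`,
`v(3^k w + 8) = 1` and `k ≥ 1`. [folklore] -/
theorem valuation_w_eq_one {w K : AlgebraicClosure ℚ} {k : ℕ} (hk : 1 ≤ k)
    (hK : (placeOver 3).valuation K = 1)
    (h8 : (placeOver 3).valuation ((3 : AlgebraicClosure ℚ) ^ k * w + 8) = 1)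
    (hR : w ^ 3 * ((3 : AlgebraicClosure ℚ) ^ k * w + 8) = K * ((3 : AlgebraicClosure ℚ) ^ k * w - 1)) :
    (placeOver 3).valuation w = 1 := by
  set v := (placeOver 3).valuation with hv
  set t := v (3 : AlgebraicClosure ℚ) with ht
  have ht1 : t < 1 := valuation_three_lt_one
  have ht0 : t ≠ 0 := valuation_three_ne_zero
  have htk1 : t ^ k < 1 := pow_lt_one₀ zero_le ht1 (by omega)
  have key : v w ^ 3 = v ((3 : AlgebraicClosure ℚ) ^ k * w - 1) := by
    have := congrArg v hR
    rw [map_mul, map_pow, h8, mul_one, map_mul, hK, one_mul] at this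
    exact this
  have h3w : v ((3 : AlgebraicClosure ℚ) ^ k * w) = t ^ k * v w := by rw [map_mul, map_pow]
  rcases le_or_gt (v w) 1 with hle | hgt
  · -- `v(3^k w) < 1`, so `v(3^k w − 1) = 1`
    have hlt : v ((3 : AlgebraicClosure ℚ) ^ k * w) < v (1 : AlgebraicClosure ℚ) := by
      rw [h3w, map_one]
      calc t ^ k * v w ≤ t ^ k * 1 := mul_le_mul' le_rfl hle
        _ = t ^ k := mul_one _
        _ < 1 := htk1
    rw [valuation_sub_eq_of_lt' hlt, map_one] at key
    rcases lt_trichotomy (v w) 1 with h | h | h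
    · exact absurd key (ne_of_lt (pow_lt_one₀ zero_le h three_ne_zero))
    · exact h
    · exact absurd hle (not_le.mpr h)
  · exfalso
    rcases le_or_gt (v ((3 : AlgebraicClosure ℚ) ^ k * w)) 1 with h1 | h1
    · have : v ((3 : AlgebraicClosure ℚ) ^ k * w - 1) ≤ 1 :=
        (Valuation.map_sub _ _ _).trans (max_le h1 (by rw [map_one]))
      rw [← key] at this
      exact absurd (one_lt_pow₀ hgt three_ne_zero) (not_lt.mpr this)
    · have e : v ((3 : AlgebraicClosure ℚ) ^ k * w - 1) = t ^ k * v w := by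
        rw [valuation_sub_eq_of_lt (by rw [map_one]; exact h1), h3w]
      rw [e] at key
      -- `v(w)³ = t^k v(w)` forces `v(w)² = t^k < 1`
      have hw0 : v w ≠ 0 := ne_of_gt (lt_trans zero_lt_one hgt)
      have h2 : v w ^ 2 = t ^ k := by
        have : v w ^ 2 * v w = t ^ k * v w := by rw [← pow_succ]; exact key
        exact mul_right_cancel₀ hw0 this
      have : (1 : _) < v w ^ 2 := one_lt_pow₀ hgt two_ne_zero
      rw [h2] at this
      exact absurd this (not_lt.mpr htk1.le)

/-- **`v(w³ − w₀) = v(3)`** when moreover `K ≡ −2w₀ (mod 9)` (`w₀ = ±1`): indeed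
`(w³ − w₀)(3^k w + 8) = (K − w₀)3^k w − (K + 8w₀)` with `v((K − w₀)3^k w) ≤ t^{k+1} ≤ t²` and
`K + 8w₀ = (K + 2w₀) + 6w₀` of valuation exactly `t`. [folklore] -/
theorem valuation_w_cube_sub_eq {w K w₀ : AlgebraicClosure ℚ} {k : ℕ} (hk : 1 ≤ k)
    (hw₀ : w₀ = 1 ∨ w₀ = -1)
    (hK2 : (placeOver 3).valuation (K + 2 * w₀) ≤ (placeOver 3).valuation (3 : AlgebraicClosure ℚ) ^ 2)
    (hw : (placeOver 3).valuation w = 1)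
    (h8 : (placeOver 3).valuation ((3 : AlgebraicClosure ℚ) ^ k * w + 8) = 1)
    (hR : w ^ 3 * ((3 : AlgebraicClosure ℚ) ^ k * w + 8) = K * ((3 : AlgebraicClosure ℚ) ^ k * w - 1)) :
    (placeOver 3).valuation (w ^ 3 - w₀) = (placeOver 3).valuation (3 : AlgebraicClosure ℚ) := by
  set v := (placeOver 3).valuation with hv
  set t := v (3 : AlgebraicClosure ℚ) with ht
  have ht1 : t < 1 := valuation_three_lt_one
  have ht0 : t ≠ 0 := valuation_three_ne_zero
  have ht0' : 0 < t := zero_lt_iff.mpr ht0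
  have ht2t : t ^ 2 < t := by
    calc t ^ 2 = t * t := pow_two t
      _ < t * 1 := mul_lt_mul_of_pos_left ht1 ht0'
      _ = t := mul_one t
  have hvw₀ : v w₀ = 1 := by
    rcases hw₀ with h | h
    · rw [h, map_one]
    · rw [h, Valuation.map_neg, map_one]
  have h2 : v (2 : AlgebraicClosure ℚ) = 1 := by
    simpa using valuation_intCast_eq_one_of_not_dvd (n := 2) (by decide)
  -- `v(K + 8w₀) = t`
  have hK8 : v (K + 8 * w₀) = t := by
    have e : K + 8 * w₀ = 2 * 3 * w₀ + (K + 2 * w₀) := by ring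
    have hm : v (2 * 3 * w₀) = t := by rw [map_mul, map_mul, h2, hvw₀, one_mul, mul_one]
    rw [e, Valuation.map_add_eq_of_lt_left _ (by rw [hm]; exact hK2.trans_lt ht2t), hm]
  -- `v((K − w₀) 3^k w) ≤ t²`
  have hKw : v ((K - w₀) * (3 : AlgebraicClosure ℚ) ^ k * w) ≤ t ^ 2 := by
    have hKw₀ : v (K - w₀) ≤ t := by
      have e : K - w₀ = (K + 2 * w₀) - 3 * w₀ := by ring
      rw [e]
      refine (Valuation.map_sub _ _ _).trans (max_le (hK2.trans ht2t.le) ?_)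
      rw [map_mul, hvw₀, mul_one]
    rw [map_mul, map_mul, map_pow, hw, mul_one]
    calc v (K - w₀) * t ^ k ≤ t * t ^ 1 :=
          mul_le_mul' hKw₀ (pow_le_pow_right_of_le_one' ht1.le hk)
      _ = t ^ 2 := by rw [pow_one, pow_two]
  -- the identity
  have hid : (w ^ 3 - w₀) * ((3 : AlgebraicClosure ℚ) ^ k * w + 8) =
      (K - w₀) * (3 : AlgebraicClosure ℚ) ^ k * w - (K + 8 * w₀) := by
    linear_combination hR
  have hval := congrArg v hid
  rw [map_mul, h8, mul_one] at hval
  rw [hval, valuation_sub_eq_of_lt' (by rw [hK8]; exact hKw.trans_lt ht2t), hK8]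

/-! ### §2 The cube-root lemma at integral level: `v(X³ − 1) = v(3)` ⟹ `v(X − 1)³ = v(3)` -/

/-- **`v(X³ − 1) = v(3)` forces `v(X − 1)³ = v(3)`** (`X³ − 1 = (X − 1)(X − ω)(X − ω²)`,
`v(1 − ω)² = v(3)`: if `v(X − 1) ≤ v(1 − ω)` the product would be at most `v(3)^{3/2}`). [folklore] -/
theorem valuation_sub_one_pow_three_of_cube_eq {X : AlgebraicClosure ℚ}
    (h : (placeOver 3).valuation (X ^ 3 - 1) = (placeOver 3).valuation (3 : AlgebraicClosure ℚ)) :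
    (placeOver 3).valuation (X - 1) ^ 3 = (placeOver 3).valuation (3 : AlgebraicClosure ℚ) := by
  set v := (placeOver 3).valuation with hv
  set t := v (3 : AlgebraicClosure ℚ) with ht
  have ht1 : t < 1 := valuation_three_lt_one
  have ht0 : t ≠ 0 := valuation_three_ne_zero
  have ht0' : 0 < t := zero_lt_iff.mpr ht0
  obtain ⟨δ, hδ⟩ := IsAlgClosed.exists_pow_nat_eq (-3 : AlgebraicClosure ℚ) (by norm_num : 0 < 2)
  set ω : AlgebraicClosure ℚ := (-1 + δ) / 2 with hω
  have hω2 : ω ^ 2 + ω + 1 = 0 := by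
    rw [hω]; field_simp; linear_combination hδ
  have hfac : X ^ 3 - 1 = (X - 1) * ((X - ω) * (X - ω ^ 2)) := by
    linear_combination (X - 1) * (X - ω + 1) * hω2
  have h3 : (1 - ω) * (1 - ω ^ 2) = 3 := by linear_combination (ω - 2) * hω2
  have hω3 : ω ^ 3 = 1 := by linear_combination (ω - 1) * hω2
  have hvω : v ω = 1 := by
    have h1 : v ω ^ 3 = 1 := by rw [← map_pow, hω3, map_one]
    rcases lt_trichotomy (v ω) 1 with hlt | heq | hgt
    · exact absurd h1 (ne_of_lt (pow_lt_one₀ zero_le hlt (by norm_num)))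
    · exact heq
    · exact absurd h1 (ne_of_gt (one_lt_pow₀ hgt (by norm_num)))
  have hb : v (1 - ω ^ 2) = v (1 - ω) := by
    rw [show (1 : AlgebraicClosure ℚ) - ω ^ 2 = (1 - ω) * (1 + ω) by ring, map_mul,
      show (1 : AlgebraicClosure ℚ) + ω = -ω ^ 2 by linear_combination hω2, Valuation.map_neg, map_pow,
      hvω, one_pow, mul_one]
  set b := v (1 - ω) with hbdef
  have hb2 : b ^ 2 = t := by
    have := congrArg v h3; rw [map_mul, hb] at this; rw [pow_two]; exact this
  have hb1 : b < 1 := by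
    by_contra hb1; rw [not_lt] at hb1
    have : 1 ≤ b ^ 2 := one_le_pow₀ hb1
    rw [hb2] at this; exact absurd ht1 (not_lt.mpr this)
  set a := v (X - 1) with ha
  have hprod : v (X ^ 3 - 1) = a * (v (X - ω) * v (X - ω ^ 2)) := by rw [hfac, map_mul, map_mul]
  rcases lt_trichotomy a b with hab | hab | hab
  · -- `a < b`: `v(X³ − 1) = a·t < t`
    exfalso
    have e1 : v (X - ω) = b := by
      rw [show X - ω = (X - 1) + (1 - ω) by ring]; exact Valuation.map_add_eq_of_lt_right _ hab
    have e2 : v (X - ω ^ 2) = b := by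
      rw [show X - ω ^ 2 = (X - 1) + (1 - ω ^ 2) by ring, ← hb]
      exact Valuation.map_add_eq_of_lt_right _ (by rw [hb]; exact hab)
    rw [hprod, e1, e2, ← pow_two, hb2] at h
    have : a * t < 1 * t := mul_lt_mul_of_pos_right (hab.trans hb1) ht0'
    rw [one_mul, h] at this
    exact lt_irrefl _ this
  · -- `a = b`: `v(X³ − 1) ≤ b·t < t`
    exfalso
    have e1 : v (X - ω) ≤ b := by
      rw [show X - ω = (X - 1) + (1 - ω) by ring]
      exact (Valuation.map_add _ _ _).trans (max_le hab.le le_rfl)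
    have e2 : v (X - ω ^ 2) ≤ b := by
      rw [show X - ω ^ 2 = (X - 1) + (1 - ω ^ 2) by ring]
      exact (Valuation.map_add _ _ _).trans (max_le hab.le hb.le)
    have hle : v (X ^ 3 - 1) ≤ b * t := by
      rw [hprod, hab]
      calc b * (v (X - ω) * v (X - ω ^ 2)) ≤ b * (b * b) := mul_le_mul' le_rfl (mul_le_mul' e1 e2)
        _ = b * t := by rw [← pow_two, hb2]
    rw [h] at hle
    have : b * t < 1 * t := mul_lt_mul_of_pos_right hb1 ht0'
    rw [one_mul] at this
    exact absurd hle (not_le.mpr this)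
  · -- `a > b`: all three factors have valuation `a`
    have e1 : v (X - ω) = a := by
      rw [show X - ω = (X - 1) + (1 - ω) by ring]; exact Valuation.map_add_eq_of_lt_left _ hab
    have e2 : v (X - ω ^ 2) = a := by
      rw [show X - ω ^ 2 = (X - 1) + (1 - ω ^ 2) by ring]
      exact Valuation.map_add_eq_of_lt_left _ (by rw [hb]; exact hab)
    rw [hprod, e1, e2] at h
    rw [← h]
    simp only [pow_succ, pow_zero, one_mul, mul_assoc]

/-- Hence **`v(w − w₀)³ = v(3)`** (apply §2 to `X = w₀ w`, `w₀² = 1`). [folklore] -/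
theorem valuation_w_sub_pow_three_eq {w w₀ : AlgebraicClosure ℚ} (hw₀ : w₀ = 1 ∨ w₀ = -1)
    (h : (placeOver 3).valuation (w ^ 3 - w₀) = (placeOver 3).valuation (3 : AlgebraicClosure ℚ)) :
    (placeOver 3).valuation (w - w₀) ^ 3 = (placeOver 3).valuation (3 : AlgebraicClosure ℚ) := by
  have hsq : w₀ ^ 2 = 1 := by rcases hw₀ with h | h <;> rw [h] <;> norm_num
  have hv₀ : (placeOver 3).valuation w₀ = 1 := by
    rcases hw₀ with h | h
    · rw [h, map_one]
    · rw [h, Valuation.map_neg, map_one]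
  have e3 : (w₀ * w) ^ 3 - 1 = w₀ * (w ^ 3 - w₀) := by linear_combination (w₀ * w ^ 3 + 1) * hsq
  have e1 : w₀ * w - 1 = w₀ * (w - w₀) := by linear_combination hsq
  have h' := valuation_sub_one_pow_three_of_cube_eq (X := w₀ * w)
    (by rw [e3, map_mul, hv₀, one_mul]; exact h)
  rw [e1, map_mul, hv₀, one_mul] at h'
  exact h'

/-! ### §3 The numerator of `X³ − 1` -/

/-- **`v(−8w₀(w − w₀)³ − 3(3^k w + 8)) = v(3)·v(w − w₀)`.**  With `(w − w₀)³ = (w³ − w₀) −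
3w₀w(w − w₀)` and `(w³ − w₀)(3^k w + 8) = (K − w₀)3^k w − (K + 8w₀)`:
`N·(3^k w + 8) = 24w(w − w₀)(3^k w + 8) − 8w₀·3^k(K − w₀)w + 8w₀(K + 8w₀) − 3(3^k w + 8)²`, where the
first term has valuation `t·v(w − w₀)` and the rest `≤ t²` (`64·8w₀² − 192 = −128 + …`:
`8w₀(K + 8w₀) − 192 = 8w₀(K + 2w₀) − 144`). [folklore] -/
theorem valuation_numerator_of_delta_quartic {w K w₀ : AlgebraicClosure ℚ} {k : ℕ} (hk : 1 ≤ k)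
    (hw₀ : w₀ = 1 ∨ w₀ = -1)
    (hK2 : (placeOver 3).valuation (K + 2 * w₀) ≤ (placeOver 3).valuation (3 : AlgebraicClosure ℚ) ^ 2)
    (hw : (placeOver 3).valuation w = 1)
    (h8' : (placeOver 3).valuation ((3 : AlgebraicClosure ℚ) ^ k * w + 8) = 1)
    (hR : w ^ 3 * ((3 : AlgebraicClosure ℚ) ^ k * w + 8) = K * ((3 : AlgebraicClosure ℚ) ^ k * w - 1))
    (hs : (placeOver 3).valuation (w - w₀) ^ 3 = (placeOver 3).valuation (3 : AlgebraicClosure ℚ)) :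
    (placeOver 3).valuation (-8 * w₀ * (w - w₀) ^ 3 - 3 * ((3 : AlgebraicClosure ℚ) ^ k * w + 8)) =
      (placeOver 3).valuation (3 : AlgebraicClosure ℚ) * (placeOver 3).valuation (w - w₀) := by
  set v := (placeOver 3).valuation with hv
  set t := v (3 : AlgebraicClosure ℚ) with ht
  set s := v (w - w₀) with hsdef
  have ht1 : t < 1 := valuation_three_lt_one
  have ht0 : t ≠ 0 := valuation_three_ne_zero
  have ht0' : 0 < t := zero_lt_iff.mpr ht0
  have hsq : w₀ ^ 2 = 1 := by rcases hw₀ with h | h <;> rw [h] <;> norm_num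
  have hvw₀ : v w₀ = 1 := by
    rcases hw₀ with h | h
    · rw [h, map_one]
    · rw [h, Valuation.map_neg, map_one]
  have hunit : ∀ n : ℤ, ¬ (3 : ℤ) ∣ n → v (n : AlgebraicClosure ℚ) = 1 := fun n hn ↦
    valuation_intCast_eq_one_of_not_dvd hn
  have ht2t : t ^ 2 < t := by
    calc t ^ 2 = t * t := pow_two t
      _ < t * 1 := mul_lt_mul_of_pos_left ht1 ht0'
      _ = t := mul_one t
  -- `t < s` (from `s³ = t < 1`)
  have hs0' : 0 < s := by
    rcases eq_or_lt_of_le (zero_le : (0 : _) ≤ s) with h | h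
    · exfalso
      have : s ^ 3 = 0 := by rw [← h, zero_pow three_ne_zero]
      rw [hs] at this; exact ht0 this
    · exact h
  have hts : t < s := by
    refine lt_of_pow_lt_pow_left₀ 3 hs0'.le ?_
    rw [hs]
    calc t ^ 3 = t * t ^ 2 := by rw [← pow_succ']
      _ < t * 1 := mul_lt_mul_of_pos_left (pow_lt_one₀ zero_le ht1 two_ne_zero) ht0'
      _ = t := mul_one t
  have ht2ts : t ^ 2 < t * s := by
    rw [pow_two]; exact mul_lt_mul_of_pos_left hts ht0'
  -- the identity for `N·(3^k w + 8)`: main term `24·P·w·(w − w₀)`, `P = 3^k w + 8`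
  have hid : (-8 * w₀ * (w - w₀) ^ 3 - 3 * ((3 : AlgebraicClosure ℚ) ^ k * w + 8)) *
      ((3 : AlgebraicClosure ℚ) ^ k * w + 8) =
      24 * ((3 : AlgebraicClosure ℚ) ^ k * w + 8) * w * (w - w₀) +
        (-8 * (3 : AlgebraicClosure ℚ) ^ k * w₀ * K * w + 8 * w₀ * K +
          8 * ((3 : AlgebraicClosure ℚ) ^ k * w + 8) - 3 * ((3 : AlgebraicClosure ℚ) ^ k * w + 8) ^ 2) := by
    linear_combination (-8 * w₀) * hR +
      (((3 : AlgebraicClosure ℚ) ^ k * w + 8) * (24 * w ^ 2 - 24 * w₀ * w + 8 * w₀ ^ 2 + 8)) * hsq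
  -- the remainder is `O(9)`
  have hrest_id : -8 * (3 : AlgebraicClosure ℚ) ^ k * w₀ * K * w + 8 * w₀ * K +
      8 * ((3 : AlgebraicClosure ℚ) ^ k * w + 8) - 3 * ((3 : AlgebraicClosure ℚ) ^ k * w + 8) ^ 2 =
      8 * w₀ * (K + 2 * w₀) * (1 - (3 : AlgebraicClosure ℚ) ^ k * w) -
        24 * ((3 : AlgebraicClosure ℚ) ^ k * w) - 144 - 3 * ((3 : AlgebraicClosure ℚ) ^ k * w) ^ 2 := by
    linear_combination (16 * ((3 : AlgebraicClosure ℚ) ^ k * w - 1)) * hsq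
  have h3k : v ((3 : AlgebraicClosure ℚ) ^ k * w) ≤ t := by
    rw [map_mul, map_pow, hw, mul_one]
    exact pow_le_of_le_one zero_le ht1.le (by omega)
  have hrest : v (-8 * (3 : AlgebraicClosure ℚ) ^ k * w₀ * K * w + 8 * w₀ * K +
      8 * ((3 : AlgebraicClosure ℚ) ^ k * w + 8) - 3 * ((3 : AlgebraicClosure ℚ) ^ k * w + 8) ^ 2) ≤
      t ^ 2 := by
    rw [hrest_id]
    have h8 : v (8 : AlgebraicClosure ℚ) = 1 := by simpa using hunit 8 (by decide)
    have h16 : v (16 : AlgebraicClosure ℚ) = 1 := by simpa using hunit 16 (by decide)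
    refine (Valuation.map_sub _ _ _).trans (max_le ?_ ?_)
    · refine (Valuation.map_sub _ _ _).trans (max_le ?_ ?_)
      · refine (Valuation.map_sub _ _ _).trans (max_le ?_ ?_)
        · rw [map_mul, map_mul, map_mul, h8, hvw₀, one_mul, one_mul]
          calc v (K + 2 * w₀) * v (1 - (3 : AlgebraicClosure ℚ) ^ k * w) ≤ t ^ 2 * 1 :=
                mul_le_mul' hK2 ((Valuation.map_sub _ _ _).trans (max_le (by rw [map_one])
                  (h3k.trans ht1.le)))
            _ = t ^ 2 := mul_one _
        · rw [show (24 : AlgebraicClosure ℚ) = 8 * 3 by norm_num, map_mul, map_mul, h8, one_mul, pow_two]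
          exact mul_le_mul' le_rfl h3k
      · rw [show (144 : AlgebraicClosure ℚ) = 16 * 3 ^ 2 by norm_num, map_mul, map_pow, h16, one_mul]
    · have e : v (3 * ((3 : AlgebraicClosure ℚ) ^ k * w) ^ 2) = t * v ((3 : AlgebraicClosure ℚ) ^ k * w) ^ 2 := by
        rw [map_mul, map_pow]
      rw [e]
      calc t * v ((3 : AlgebraicClosure ℚ) ^ k * w) ^ 2 ≤ t * t ^ 2 :=
            mul_le_mul' le_rfl (pow_le_pow_left₀ zero_le h3k 2)
        _ ≤ 1 * t ^ 2 := mul_le_mul' ht1.le le_rfl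
        _ = t ^ 2 := one_mul _
  have hmain : v (24 * ((3 : AlgebraicClosure ℚ) ^ k * w + 8) * w * (w - w₀)) = t * s := by
    have h8 : v (8 : AlgebraicClosure ℚ) = 1 := by simpa using hunit 8 (by decide)
    rw [map_mul, map_mul, map_mul, show (24 : AlgebraicClosure ℚ) = 8 * 3 by norm_num, map_mul, h8,
      one_mul, h8', hw, mul_one, mul_one]
  have hsum : v (24 * ((3 : AlgebraicClosure ℚ) ^ k * w + 8) * w * (w - w₀) +
      (-8 * (3 : AlgebraicClosure ℚ) ^ k * w₀ * K * w + 8 * w₀ * K +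
        8 * ((3 : AlgebraicClosure ℚ) ^ k * w + 8) - 3 * ((3 : AlgebraicClosure ℚ) ^ k * w + 8) ^ 2)) =
      t * s := by
    rw [Valuation.map_add_eq_of_lt_left _ (by rw [hmain]; exact hrest.trans_lt ht2ts), hmain]
  have := congrArg v hid
  rw [map_mul, h8', mul_one, hsum] at this
  exact this

end Summit.BirchSwinnertonDyer.Rank1Residual.GaloisImage
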